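/-
Copyright (c) 2026 the pub-hodgecm-mathlib formalisation cell (harness21).  Prover seat hodgecm-mathlib-K2Liu-p10 (g3), Track B «K2-LIT»,
#184♮ = hLiu418 = `stmt-HodgeConjecture-24832`; Road Φ of socket #41, Φ9 arch layer: the SEAM «junction (4) → (6a′)» as a NAMED theorem
(K2E5-p16 (g5) 10:24:55Z «→ K2Liu-p10 (g3) (Φ9): feed faces (i)(ii) to ★ (6a′)»; statement and proof = K2E5-r01 (g8)'s kernel-checked HOME probe
`K2/K2E5-r01/g8/TieJunction4Phi9.K2E5-r01-g8.lean` 10:32:29Z, landed here so that Φ9's assembly cites ONE name).  THEOREMS ONLY.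
-/
import Summits.HodgeConjecture.HodgeConjecture.Theorems.K2LiuKFiniteSectionWhittakerHolomorphyGrowth   -- ★ p859350 junction (4) (K2E5-p16 (g5))
import Summits.HodgeConjecture.HodgeConjecture.Theorems.K2LiuHolomorphicLatticeSeriesOfBounds           -- ★ p859163 (6a′)
import HarnessLib

/-!
# Crux `HLiu418`, Road Φ, Φ9 arch layer: HOLOMORPHY OF THE ARCHIMEDEAN WHITTAKER LATTICE SUM OF A `K_∞`-FINITE SECTION

Cell `hodgecm-mathlib`, crux item hLiu418 = `stmt-HodgeConjecture-24832` (helper lane, count-neutral).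
`differentiableOn_tsum_whittaker_of_kFinite`: for a finite set `S` of complex places with `K_σ`-types `k σ` and polynomial `K_σ`-finite vectors `P σ`, the
per-place packages `F_σ` of ★ `kFiniteSection_whittaker_holomorphy_growth` (chosen once per `σ`, with `h`-free growth constants) (a) ARE the archimedean
Whittaker integrals of every `K_σ`-finite Siegel section of type `(k σ, P σ)` on `re s > s₀ σ`, and (b) discharge the `hF`∕`hFb` inputs of ★ (6a′)
`differentiableOn_tsum_prod_of_bounds` with `F i σ := F_σ (h i σ)`, `w i σ := exp(−π tr h_{iσ})`, on any open window `U ⊆ ⋂_σ {0 < re(s + 1 + k σ ∕ 2)}`: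
the lattice sum `s ↦ Σ'_i c_i(s) ∏_σ F_σ(h_{iσ}, s)` is holomorphic on `U`, the lattice-side inputs `c, hc, hcb, hsum` (★ (H2)∕(6a) at `g := ½·1`) being carried
as hypotheses (Φ9 assembly supplies them).
Sources: [Shimura1997, §16.4]; [Liu2011, §4D].
HONEST LABEL.  Helper lemma, count-neutral; `HC_CM` is proved only modulo the 7 printed citations (2 remaining named inputs:
hLiu418 = `stmt-HodgeConjecture-24832`, h413 = `stmt-HodgeConjecture-24833`) until rung 0 closes.
-/

set_option autoImplicit false
set_option linter.dupNamespace false -- the mandated namespace repeats `HodgeConjecture.HodgeConjecture`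

noncomputable section

open scoped Matrix ComplexConjugate ComplexOrder MatrixOrder
open Complex Matrix MeasureTheory Set
open Literature.NumberTheory.ModularForms.SiegelUpperHalfSpace (moeb)
open Summit.HodgeConjecture.HodgeConjecture.Cruxes.HLiu418
open Summit.HodgeConjecture.HodgeConjecture.Cruxes.HLiu418.K2LiuHermTwoGammaDefs
open Summit.HodgeConjecture.HodgeConjecture.Cruxes.HLiu418.K2LiuHermTwoConfluentXiDefs

namespace Summit.HodgeConjecture.HodgeConjecture.Cruxes.HLiu418.K2LiuKFiniteWhittakerSumHolomorphy

/-- **HOLOMORPHY OF THE ARCHIMEDEAN WHITTAKER LATTICE SUM OF A `K_∞`-FINITE SECTION** (seam «junction (4) → (6a′)»): see the module docstring.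
[cite: Shimura1997, §16.4] [cite: Liu2011, §4D] -/
theorem differentiableOn_tsum_whittaker_of_kFinite {ι S : Type*} [Fintype S]
    (P : S → MvPolynomial (((Fin 2 ⊕ Fin 2) × (Fin 2 ⊕ Fin 2)) ⊕ ((Fin 2 ⊕ Fin 2) × (Fin 2 ⊕ Fin 2))) ℂ) (k : S → ℤ)
    (h : ι → S → Matrix (Fin 2) (Fin 2) ℂ) (hh : ∀ i σ, (h i σ).PosDef)
    {U : Set ℂ} (hU : IsOpen U) (hUk : ∀ σ, ∀ s ∈ U, 0 < (s + 1 + (k σ : ℂ) / 2).re)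
    (c : ι → ℂ → ℂ) (hc : ∀ i, DifferentiableOn ℂ (c i) U)
    (hcb : ∀ K ⊆ U, IsCompact K → ∃ A M : ℝ, 0 ≤ A ∧ ∀ i, ∀ s ∈ K, ‖c i s‖ ≤ A * ∏ σ, (1 + ((h i σ 0 0).re + (h i σ 1 1).re)) ^ M)
    (hsum : ∀ N N' : ℝ, 0 ≤ N → 0 ≤ N' → Summable fun i => ∏ σ, (Real.exp (-(Real.pi * ((h i σ 0 0).re + (h i σ 1 1).re))) *
      (1 + ((h i σ 0 0).re + (h i σ 1 1).re)) ^ N * (1 + ((h i σ 0 0).re * (h i σ 1 1).re - normSq (h i σ 0 1)) ^ (-N')))) :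
    ∃ (F : S → Matrix (Fin 2) (Fin 2) ℂ → ℂ → ℂ) (s₀ : S → ℝ),
      (∀ σ : S, (∀ (h : Matrix (Fin 2) (Fin 2) ℂ), h.PosDef → ∀ (s : ℂ), s₀ σ < s.re → ∀ (f : Matrix (Fin 2 ⊕ Fin 2) (Fin 2 ⊕ Fin 2) ℂ → ℂ),
        K2LiuArchInducedTubeDefs.IsArchSiegelSection (fun z : ℂ => (conj z / ((‖z‖ : ℝ) : ℂ)) ^ k σ) s f →
        (∀ u : Matrix (Fin 2 ⊕ Fin 2) (Fin 2 ⊕ Fin 2) ℂ, uᴴ * Matrix.J (Fin 2) ℂ * u = Matrix.J (Fin 2) ℂ → moeb u (I • (1 : Matrix (Fin 2) (Fin 2) ℂ)) = I • 1 →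
          f u = MvPolynomial.eval (Sum.elim (fun pq => u pq.1 pq.2) (fun pq => conj (u pq.1 pq.2))) (P σ)) →
        ∫ c : ℝ × ℂ × ℝ, f (Matrix.J (Fin 2) ℂ * fromBlocks 1 (hermTwo c) 0 1) * cexp (-(2 * Real.pi * I) * (h * hermTwo c).trace) = F σ h s)) ∧
      DifferentiableOn ℂ (fun s : ℂ => ∑' i, c i s * ∏ σ, F σ (h i σ) s) U := by
  choose F s₀ hF using fun σ =>
    K2LiuKFiniteSectionWhittakerHolomorphyGrowth.kFiniteSection_whittaker_holomorphy_growth (P σ) (k σ)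
  refine ⟨F, s₀, fun σ => (hF σ).2.2, ?_⟩
  exact K2LiuHolomorphicLatticeSeriesOfBounds.differentiableOn_tsum_prod_of_bounds h hh
    (fun i σ => Real.exp (-(Real.pi * ((h i σ 0 0).re + (h i σ 1 1).re)))) (fun _ _ => (Real.exp_pos _).le)
    (fun i σ => F σ (h i σ)) hU (fun i σ => (hF σ).1 hU (hUk σ) (hh i σ))
    (fun K hKU hK σ => by
      obtain ⟨C, N, N', hC, hN, hN', hb⟩ := (hF σ).2.1 hK (fun s hs => hUk σ s (hKU hs))
      exact ⟨C, N, N', hC, hN, hN', fun i s hs => hb (h i σ) (hh i σ) s hs⟩)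
    c hc hcb hsum

end Summit.HodgeConjecture.HodgeConjecture.Cruxes.HLiu418.K2LiuKFiniteWhittakerSumHolomorphy

end
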